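import Mathlib
import Summits.Ventures.PercRepro2.TypedContract
import Summits.Ventures.PercRepro2.FiveTypedAll

/-!
# The typed reduction calculus on a general base: `|F| ≤ 5` and the root-untouched rule
(blind cell PercRepro2, night-3 g5, 2026-08-25; `proofs/NIGHT3-CERT.md` §14)

`RedM` (TypedContract.lean) is the minor-closed class of typed instances that reduce — by
contraction of pinned-open edges, the root-pair / loop / leaf / pendant rules and the parallel /
series rules — to at most THREE typed edges.  Here the class is stated with an arbitrary base
predicate `B` (`RedMGen B`): the same rules, the base case `B`.  `typedCount_nonneg_of_redMGen`
is the reduction theorem for every base on which the typed count is nonnegative.  Two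
instances:

* **`RedM5 := RedMGen Base5`** with `Base5 = |F| ≤ 5` — row 2′TRI on every instance reducing to
  at most FIVE typed edges (`FiveTypedAll`): `typedCount_nonneg_of_redM5`, with the weighted
  corollaries `Gc_nonneg_of_redM5` / `ZDelta_of_redM5`;
* `RedM ⊆ RedM5` (`redM5_of_redM`): the |F| ≤ 3 class is contained in the new one.

(The root-untouched vanishing of `TypedUntouched.lean` enters as a further base in
`TypedReduce5U.lean`.)
-/

namespace Summit.Ventures.PercRepro2

open UnionCluster

namespace CovForm

namespace TypedRed

open Contract

section RedMGen

variable {V : Type*} {E : Type*} [DecidableEq V] [Fintype E] [DecidableEq E]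

/-- The typed reduction class over a base predicate `B`: the rules of `RedM` with the base
case replaced by `B`. -/
inductive RedMGen (B : (E → Sym2 V) → V → V → V → V → V → Finset E → Config E → (E → ℕ) → Prop) :
    (E → Sym2 V) → V → V → V → V → V → Finset E → Config E → (E → ℕ) → Prop
  | base (ends : E → Sym2 V) (o a₁ a₂ a₃ b : V) (F : Finset E) (z : Config E) (τ : E → ℕ)
      (hB : B ends o a₁ a₂ a₃ b F z τ) : RedMGen B ends o a₁ a₂ a₃ b F z τ
  | contract (ends : E → Sym2 V) (o a₁ a₂ a₃ b : V) (F : Finset E) (z : Config E) (τ : E → ℕ)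
      {g : E} {u v : V} (hg : ends g = s(u, v)) (hgF : g ∉ F) (hz : z g = true)
      (h : RedMGen B (contractEnds ends {u, v} u) (contractMap {u, v} u o)
        (contractMap {u, v} u a₁) (contractMap {u, v} u a₂) (contractMap {u, v} u a₃)
        (contractMap {u, v} u b) F z τ) :
      RedMGen B ends o a₁ a₂ a₃ b F z τ
  | rootPair (ends : E → Sym2 V) (o a₁ a₂ a₃ b : V) (F : Finset E) (z : Config E) (τ : E → ℕ)
      {f : E} (hf : ends f = s(a₁, a₂)) (hfF : f ∈ F) : RedMGen B ends o a₁ a₂ a₃ b F z τ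
  | loop (ends : E → Sym2 V) (o a₁ a₂ a₃ b : V) (F : Finset E) (z : Config E) (τ : E → ℕ)
      {f : E} {u : V} (hf : ends f = s(u, u)) (hfF : f ∈ F)
      (h : RedMGen B ends o a₁ a₂ a₃ b (F.erase f) (Function.update z f false) τ) :
      RedMGen B ends o a₁ a₂ a₃ b F z τ
  | leaf (ends : E → Sym2 V) (o a₁ a₂ a₃ b : V) (F : Finset E) (z : Config E) (τ : E → ℕ)
      {f : E} {l u : V} (hf : ends f = s(l, u)) (hlu : l ≠ u) (hlo : l ≠ o) (hl1 : l ≠ a₁)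
      (hl2 : l ≠ a₂) (hl3 : l ≠ a₃) (hlb : l ≠ b) (hfF : f ∈ F)
      (hcl : ∀ e', e' ≠ f → l ∈ ends e' → e' ∉ F ∧ z e' = false)
      (h : RedMGen B ends o a₁ a₂ a₃ b (F.erase f) (Function.update z f false) τ) :
      RedMGen B ends o a₁ a₂ a₃ b F z τ
  | pendantB (ends : E → Sym2 V) (o a₁ a₂ a₃ b : V) (F : Finset E) (z : Config E) (τ : E → ℕ)
      {f : E} {u : V} (hf : ends f = s(b, u)) (hbu : b ≠ u) (hbo : b ≠ o) (hb1 : b ≠ a₁)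
      (hb2 : b ≠ a₂) (hb3 : b ≠ a₃) (hfF : f ∈ F)
      (hcl : ∀ e', e' ≠ f → b ∈ ends e' → e' ∉ F ∧ z e' = false)
      (h : RedMGen B ends o a₁ a₂ a₃ b (F.erase f) (Function.update z f true) τ) :
      RedMGen B ends o a₁ a₂ a₃ b F z τ
  | pendantO (ends : E → Sym2 V) (o a₁ a₂ a₃ b : V) (F : Finset E) (z : Config E) (τ : E → ℕ)
      {f : E} {u : V} (hf : ends f = s(o, u)) (hou : o ≠ u) (ho1 : o ≠ a₁) (ho2 : o ≠ a₂)
      (ho3 : o ≠ a₃) (hob : o ≠ b) (hfF : f ∈ F)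
      (hcl : ∀ e', e' ≠ f → o ∈ ends e' → e' ∉ F ∧ z e' = false)
      (h : RedMGen B ends o a₁ a₂ a₃ b (F.erase f) (Function.update z f true) τ) :
      RedMGen B ends o a₁ a₂ a₃ b F z τ
  | parallel (ends : E → Sym2 V) (o a₁ a₂ a₃ b : V) (F : Finset E) (z : Config E) (τ : E → ℕ)
      {e f : E} (hef : e ≠ f) (hpar : ends e = ends f) (heF : e ∈ F) (hfF : f ∈ F)
      (h1 : RedMGen B ends o a₁ a₂ a₃ b (F.erase f) (Function.update z f false)
        (Function.update τ e 1))
      (h2 : RedMGen B ends o a₁ a₂ a₃ b (F.erase f) (Function.update z f false)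
        (Function.update τ e 2))
      (h3 : RedMGen B ends o a₁ a₂ a₃ b ((F.erase f).erase e)
        (Function.update (Function.update z f false) e true) τ) :
      RedMGen B ends o a₁ a₂ a₃ b F z τ
  | series (ends : E → Sym2 V) (o a₁ a₂ a₃ b : V) (F : Finset E) (z : Config E) (τ : E → ℕ)
      {e f : E} (hef : e ≠ f) {u w v : V} (he : ends e = s(u, w)) (hf : ends f = s(w, v))
      (hwu : w ≠ u) (hwv : w ≠ v) (hwo : w ≠ o) (hw1 : w ≠ a₁) (hw2 : w ≠ a₂) (hw3 : w ≠ a₃)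
      (hwb : w ≠ b) (heF : e ∈ F) (hfF : f ∈ F)
      (hcl : ∀ e', e' ≠ e → e' ≠ f → w ∈ ends e' → e' ∉ F ∧ z e' = false)
      (h0 : RedMGen B ends o a₁ a₂ a₃ b ((F.erase f).erase e)
        (Function.update (Function.update z f true) e false) τ)
      (h1 : RedMGen B ends o a₁ a₂ a₃ b (F.erase f) (Function.update z f true)
        (Function.update τ e 1))
      (h2 : RedMGen B ends o a₁ a₂ a₃ b (F.erase f) (Function.update z f true)
        (Function.update τ e 2)) :
      RedMGen B ends o a₁ a₂ a₃ b F z τ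

variable {R : Type*} [Field R] [LinearOrder R] [IsStrictOrderedRing R]

/-- **The reduction theorem over a general base**: if the typed count of `K₃` is nonnegative on
every base instance (with mixed types), it is nonnegative on the whole class `RedMGen B`. -/
theorem typedCount_nonneg_of_redMGen
    {B : (E → Sym2 V) → V → V → V → V → V → Finset E → Config E → (E → ℕ) → Prop}
    (hB : ∀ (ends : E → Sym2 V) (o a₁ a₂ a₃ b : V) (F : Finset E) (z : Config E) (τ : E → ℕ),
      B ends o a₁ a₂ a₃ b F z τ → (∀ e ∈ F, τ e = 1 ∨ τ e = 2) →
        0 ≤ typedCount F z τ (K3 ends o a₁ a₂ a₃ b : Config E → Config E → Config E → R))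
    {ends : E → Sym2 V} {o a₁ a₂ a₃ b : V} {F : Finset E} {z : Config E} {τ : E → ℕ}
    (h : RedMGen B ends o a₁ a₂ a₃ b F z τ) (hτ : ∀ e ∈ F, τ e = 1 ∨ τ e = 2) :
    0 ≤ typedCount F z τ (K3 ends o a₁ a₂ a₃ b : Config E → Config E → Config E → R) := by
  induction h with
  | base ends o a₁ a₂ a₃ b F z τ hBase =>
    exact hB ends o a₁ a₂ a₃ b F z τ hBase hτ
  | @contract ends o a₁ a₂ a₃ b F z τ g u v hg hgF hz _ ih =>
    rw [typedCount_contract_open ends o a₁ a₂ a₃ b hg F hgF z hz τ]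
    exact ih hτ
  | @rootPair ends o a₁ a₂ a₃ b F z τ f hf hfF =>
    have h1 : 1 ≤ τ f := by rcases hτ f hfF with h | h <;> omega
    rw [typedCount_root_pair ends o a₁ a₂ a₃ b hf F hfF z τ h1]
  | @loop ends o a₁ a₂ a₃ b F z τ f u hf hfF _ ih =>
    rw [typedCount_loop ends o a₁ a₂ a₃ b hf F hfF z τ,
      typedCount_type_zero F _ hfF z _ (Function.update_self _ _ _),
      typedCount_congr_τ (F.erase _) _ (τ' := τ)
        (fun e he => Function.update_of_ne (Finset.ne_of_mem_erase he) _ _)]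
    exact mul_nonneg (Nat.cast_nonneg _) (ih fun e he => hτ e (Finset.mem_of_mem_erase he))
  | @leaf ends o a₁ a₂ a₃ b F z τ f l u hf hlu hlo hl1 hl2 hl3 hlb hfF hcl _ ih =>
    rw [typedCount_unmarked_leaf' ends o a₁ a₂ a₃ b hf hlu hlo hl1 hl2 hl3 hlb F hfF z τ hcl,
      typedCount_type_zero F _ hfF z _ (Function.update_self _ _ _),
      typedCount_congr_τ (F.erase _) _ (τ' := τ)
        (fun e he => Function.update_of_ne (Finset.ne_of_mem_erase he) _ _)]
    exact mul_nonneg (Nat.cast_nonneg _) (ih fun e he => hτ e (Finset.mem_of_mem_erase he))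
  | @pendantB ends o a₁ a₂ a₃ b F z τ f u hf hbu hbo hb1 hb2 hb3 hfF hcl _ ih =>
    have h1 : 1 ≤ τ f := by rcases hτ f hfF with h | h <;> omega
    rw [typedCount_pendant_b' ends o a₁ a₂ a₃ b hf hbu hbo hb1 hb2 hb3 F hfF z τ h1 hcl,
      typedCount_type_three F _ hfF z _ (Function.update_self _ _ _),
      typedCount_congr_τ (F.erase _) _ (τ' := τ)
        (fun e he => Function.update_of_ne (Finset.ne_of_mem_erase he) _ _)]
    exact mul_nonneg (Nat.cast_nonneg _) (ih fun e he => hτ e (Finset.mem_of_mem_erase he))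
  | @pendantO ends o a₁ a₂ a₃ b F z τ f u hf hou ho1 ho2 ho3 hob hfF hcl _ ih =>
    have h1 : 1 ≤ τ f := by rcases hτ f hfF with h | h <;> omega
    rw [typedCount_pendant_o' ends o a₁ a₂ a₃ b hf hou ho1 ho2 ho3 hob F hfF z τ h1 hcl,
      typedCount_type_three F _ hfF z _ (Function.update_self _ _ _),
      typedCount_congr_τ (F.erase _) _ (τ' := τ)
        (fun e he => Function.update_of_ne (Finset.ne_of_mem_erase he) _ _)]
    exact mul_nonneg (Nat.cast_nonneg _) (ih fun e he => hτ e (Finset.mem_of_mem_erase he))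
  | @parallel ends o a₁ a₂ a₃ b F z τ e f hef hpar heF hfF _ _ _ ih1 ih2 ih3 =>
    have heF' : e ∈ F.erase f := Finset.mem_erase.2 ⟨hef, heF⟩
    rw [typedCount_parallel ends o a₁ a₂ a₃ b hef hpar F heF hfF z τ (hτ e heF) (hτ f hfF),
      Finset.sum_range_succ, Finset.sum_range_succ, Finset.sum_range_succ, Finset.sum_range_succ,
      Finset.sum_range_zero, zero_add, muOr_zero _ _ (hτ e heF) (hτ f hfF), Nat.cast_zero, zero_mul,
      zero_add]
    have hτ' : ∀ j, ∀ e' ∈ F.erase f, e' ≠ e →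
        Function.update τ e j e' = 1 ∨ Function.update τ e j e' = 2 := by
      intro j e' he' hne
      rw [Function.update_of_ne hne]
      exact hτ e' (Finset.mem_of_mem_erase he')
    refine add_nonneg (add_nonneg (mul_nonneg (Nat.cast_nonneg _) ?_)
      (mul_nonneg (Nat.cast_nonneg _) ?_)) (mul_nonneg (Nat.cast_nonneg _) ?_)
    · refine ih1 fun e' he' => ?_
      by_cases hne : e' = e
      · subst hne; rw [Function.update_self]; exact Or.inl rfl
      · exact hτ' 1 e' he' hne
    · refine ih2 fun e' he' => ?_
      by_cases hne : e' = e
      · subst hne; rw [Function.update_self]; exact Or.inr rfl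
      · exact hτ' 2 e' he' hne
    · rw [typedCount_type_three (F.erase f) e heF' _ _ (Function.update_self _ _ _),
        typedCount_congr_τ ((F.erase f).erase e) _ (τ' := τ)
          (fun e' he' => Function.update_of_ne (Finset.ne_of_mem_erase he') _ _)]
      exact ih3 fun e' he' => hτ e' (Finset.mem_of_mem_erase (Finset.mem_of_mem_erase he'))
  | @series ends o a₁ a₂ a₃ b F z τ e f hef u w v he hf hwu hwv hwo hw1 hw2 hw3 hwb heF hfF hcl
      _ _ _ ih0 ih1 ih2 =>
    have heF' : e ∈ F.erase f := Finset.mem_erase.2 ⟨hef, heF⟩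
    rw [typedCount_series ends o a₁ a₂ a₃ b hef he hf hwu hwv hwo hw1 hw2 hw3 hwb F heF hfF z τ
        (hτ e heF) (hτ f hfF) hcl,
      Finset.sum_range_succ, Finset.sum_range_succ, Finset.sum_range_succ, Finset.sum_range_succ,
      Finset.sum_range_zero, zero_add, muAnd_three _ _ (hτ e heF) (hτ f hfF), Nat.cast_zero,
      zero_mul, add_zero]
    have hτ' : ∀ j, ∀ e' ∈ F.erase f, e' ≠ e →
        Function.update τ e j e' = 1 ∨ Function.update τ e j e' = 2 := by
      intro j e' he' hne
      rw [Function.update_of_ne hne]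
      exact hτ e' (Finset.mem_of_mem_erase he')
    refine add_nonneg (add_nonneg (mul_nonneg (Nat.cast_nonneg _) ?_)
      (mul_nonneg (Nat.cast_nonneg _) ?_)) (mul_nonneg (Nat.cast_nonneg _) ?_)
    · rw [typedCount_type_zero (F.erase f) e heF' _ _ (Function.update_self _ _ _),
        typedCount_congr_τ ((F.erase f).erase e) _ (τ' := τ)
          (fun e' he' => Function.update_of_ne (Finset.ne_of_mem_erase he') _ _)]
      exact ih0 fun e' he' => hτ e' (Finset.mem_of_mem_erase (Finset.mem_of_mem_erase he'))
    · refine ih1 fun e' he' => ?_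
      by_cases hne : e' = e
      · subst hne; rw [Function.update_self]; exact Or.inl rfl
      · exact hτ' 1 e' he' hne
    · refine ih2 fun e' he' => ?_
      by_cases hne : e' = e
      · subst hne; rw [Function.update_self]; exact Or.inr rfl
      · exact hτ' 2 e' he' hne

end RedMGen

/-! ## The base `|F| ≤ 5 ∨ root untouched` -/

section RedM5

variable {V : Type*} {E : Type*} [DecidableEq V] [Fintype E] [DecidableEq E]

/-- The base of `RedM5`: at most five typed edges. -/
def Base5 (_ends : E → Sym2 V) (_o _a₁ _a₂ _a₃ _b : V) (F : Finset E) (_z : Config E)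
    (_τ : E → ℕ) : Prop :=
  F.card ≤ 5

/-- **The reducible class with base `|F| ≤ 5`.** -/
abbrev RedM5 : (E → Sym2 V) → V → V → V → V → V → Finset E → Config E → (E → ℕ) → Prop :=
  RedMGen Base5

variable {R : Type*} [Field R] [LinearOrder R] [IsStrictOrderedRing R]

omit [DecidableEq V] in
/-- The typed count is nonnegative on the base `Base5`. -/
theorem typedCount_nonneg_of_base5 (ends : E → Sym2 V) (o a₁ a₂ a₃ b : V) (F : Finset E)
    (z : Config E) (τ : E → ℕ) (hB : Base5 ends o a₁ a₂ a₃ b F z τ)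
    (hτ : ∀ e ∈ F, τ e = 1 ∨ τ e = 2) :
    0 ≤ typedCount F z τ (K3 ends o a₁ a₂ a₃ b : Config E → Config E → Config E → R) :=
  TwoTyped.typedCount_nonneg_of_card_le_five' ends o a₁ a₂ a₃ b F hB z τ hτ

/-- **Row 2′TRI on `RedM5`**: every typed count of `K₃` with mixed types whose instance reduces to
at most five typed edges is nonnegative. -/
theorem typedCount_nonneg_of_redM5 {ends : E → Sym2 V} {o a₁ a₂ a₃ b : V} {F : Finset E}
    {z : Config E} {τ : E → ℕ} (h : RedM5 ends o a₁ a₂ a₃ b F z τ)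
    (hτ : ∀ e ∈ F, τ e = 1 ∨ τ e = 2) :
    0 ≤ typedCount F z τ (K3 ends o a₁ a₂ a₃ b : Config E → Config E → Config E → R) :=
  typedCount_nonneg_of_redMGen (fun ends o a₁ a₂ a₃ b F z τ hB hτ =>
    typedCount_nonneg_of_base5 ends o a₁ a₂ a₃ b F z τ hB hτ) h hτ

omit [Fintype E] in
/-- `RedM ⊆ RedM5`: the `|F| ≤ 3` class is contained in the new one (the same rules, a weaker
base). -/
theorem redM5_of_redM {ends : E → Sym2 V} {o a₁ a₂ a₃ b : V} {F : Finset E} {z : Config E}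
    {τ : E → ℕ} (h : RedM ends o a₁ a₂ a₃ b F z τ) : RedM5 ends o a₁ a₂ a₃ b F z τ := by
  induction h with
  | base ends o a₁ a₂ a₃ b F z τ hF =>
    exact RedMGen.base ends o a₁ a₂ a₃ b F z τ (show F.card ≤ 5 by omega)
  | @contract ends o a₁ a₂ a₃ b F z τ g u v hg hgF hz _ ih =>
    exact RedMGen.contract ends o a₁ a₂ a₃ b F z τ hg hgF hz ih
  | @rootPair ends o a₁ a₂ a₃ b F z τ f hf hfF =>
    exact RedMGen.rootPair ends o a₁ a₂ a₃ b F z τ hf hfF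
  | @loop ends o a₁ a₂ a₃ b F z τ f u hf hfF _ ih =>
    exact RedMGen.loop ends o a₁ a₂ a₃ b F z τ hf hfF ih
  | @leaf ends o a₁ a₂ a₃ b F z τ f l u hf hlu hlo hl1 hl2 hl3 hlb hfF hcl _ ih =>
    exact RedMGen.leaf ends o a₁ a₂ a₃ b F z τ hf hlu hlo hl1 hl2 hl3 hlb hfF hcl ih
  | @pendantB ends o a₁ a₂ a₃ b F z τ f u hf hbu hbo hb1 hb2 hb3 hfF hcl _ ih =>
    exact RedMGen.pendantB ends o a₁ a₂ a₃ b F z τ hf hbu hbo hb1 hb2 hb3 hfF hcl ih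
  | @pendantO ends o a₁ a₂ a₃ b F z τ f u hf hou ho1 ho2 ho3 hob hfF hcl _ ih =>
    exact RedMGen.pendantO ends o a₁ a₂ a₃ b F z τ hf hou ho1 ho2 ho3 hob hfF hcl ih
  | @parallel ends o a₁ a₂ a₃ b F z τ e f hef hpar heF hfF _ _ _ ih1 ih2 ih3 =>
    exact RedMGen.parallel ends o a₁ a₂ a₃ b F z τ hef hpar heF hfF ih1 ih2 ih3
  | @series ends o a₁ a₂ a₃ b F z τ e f hef u w v he hf hwu hwv hwo hw1 hw2 hw3 hwb heF hfF hcl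
      _ _ _ ih0 ih1 ih2 =>
    exact RedMGen.series ends o a₁ a₂ a₃ b F z τ hef he hf hwu hwv hwo hw1 hw2 hw3 hwb heF hfF
      hcl ih0 ih1 ih2

end RedM5

/-! ## The weighted corollaries -/

section Weighted5

variable {V : Type*} {E : Type*} [DecidableEq V] [Fintype E] [DecidableEq E] {R : Type*} [Field R]
  [LinearOrder R] [IsStrictOrderedRing R]

/-- **(HCOV) on weight vectors whose fractional edges reduce in `RedM5`**. -/
theorem Gc_nonneg_of_redM5 (ends : E → Sym2 V) (o a₁ a₂ a₃ b : V) (p : E → R) (hp : IsProbVec p)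
    (hred : ∀ G : Finset E, G ⊆ (Finset.univ.filter fun e => p e ≠ 0 ∧ p e ≠ 1) →
      ∀ (z : Config E) (σ : E → ℕ), (∀ e ∈ G, σ e = 1 ∨ σ e = 2) →
        RedM5 ends o a₁ a₂ a₃ b G z σ) :
    0 ≤ Gc p ends o a₁ a₂ a₃ b := by
  rw [hcov_cubic p ends o a₁ a₂ a₃ b (fun _ => 0)]
  refine TwoTyped.triSum_nonneg_of_typedCount_subset (K3 ends o a₁ a₂ a₃ b)
    (Finset.univ.filter fun e => p e ≠ 0 ∧ p e ≠ 1) ?_ p (fun e => ⟨hp.nonneg e, hp.le_one e⟩) ?_ ∅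
    (Finset.empty_subset _) (fun _ => 0) (fun e he => absurd he (Finset.notMem_empty e))
  · intro G hG z σ hσ
    exact typedCount_nonneg_of_redM5 (hred G hG z σ hσ) hσ
  · intro e he
    simp only [Finset.mem_filter, Finset.mem_univ, true_and, not_and, not_not] at he
    by_cases h : p e = 0
    · exact Or.inl h
    · exact Or.inr (he h)

/-- **The crux of record (ZΔ) on weight vectors whose fractional edges reduce in `RedM5`.** -/
theorem ZDelta_of_redM5 [Fintype V] (ends : E → Sym2 V) (o a₁ a₂ a₃ b : V) (p : E → R)
    (hp : IsProbVec p)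
    (hred : ∀ G : Finset E, G ⊆ (Finset.univ.filter fun e => p e ≠ 0 ∧ p e ≠ 1) →
      ∀ (z : Config E) (σ : E → ℕ), (∀ e ∈ G, σ e = 1 ∨ σ e = 2) →
        RedM5 ends o a₁ a₂ a₃ b G z σ)
    (hord : prob p (connEvent ends a₁ b) ≤ prob p (connEvent ends a₂ b)) :
    ZDelta p ends o a₁ a₂ a₃ b :=
  ZDelta_of_HCov p hp ends hord (Gc_nonneg_of_redM5 ends o a₁ a₂ a₃ b p hp hred)

end Weighted5

end TypedRed

end CovForm

end Summit.Ventures.PercRepro2
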